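import Mathlib.Combinatorics.SimpleGraph.Clique
import HarnessLib

/-!
# Independence number of a clique-block join with a planted transversal

A finite simple graph `G` on `V` is a **clique-block join** for a block label `blk : V → β`,
a clique label `clq : V → γ` and a planted vertex set `R` when

* (H1) two distinct vertices with the same block and the same clique label are adjacent
  (each labelled class inside a block is a clique);
* (H2) two vertices of the same block with different clique labels are non-adjacent
  (the cliques of one block are mutually independent);
* (H3) two vertices of different blocks are adjacent unless both are planted
  (complete multipartite coupling between blocks, off the planted set);
* (H4) two planted vertices of different blocks are non-adjacent;
* (H5) two distinct planted vertices of the same block carry different clique labels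
  (at most one planted vertex per clique).

This is the PRE-THINNING skeleton of the structured maximum-independent-set instances
("GIC graphs": blocks of mutually independent cliques, complete bipartite coupling between
blocks, a planted independent set of representatives whose cross-block edges are deleted) of
[Choi2026GIC, §2 (p. 3)]; the degree-thinning step of that recipe, which deletes further
cross-block edges, is NOT modelled here.

Results (all proved; folklore):

* `IsCliqueBlockJoin.subset_block_or_subset_planted` — an independent set lies inside one
  block or inside `R` (a non-planted vertex sees every vertex of every other block);
* `IsCliqueBlockJoin.card_le_cliqueCount` — an independent set inside block `b` has at most
  `cliqueCount blk clq b` vertices (one per clique), and `exists_transversal` attains it;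
* `IsCliqueBlockJoin.isIndepSet_planted` — `R` is independent;
* `IsCliqueBlockJoin.indepNum_eq` — **`α(G) = max (max_b cliqueCount b) |R|`**, with the
  corollaries `indepNum_eq_card_planted` (when `|R|` dominates) and
  `eq_planted_of_card_eq` (then `R` is the unique maximum independent set);
* `card_le_sup_of_isClique_of_numbering` — the approximate-colouring bound of branch-and-bound
  maximum-clique search as printed in [TomitaSeki2003, §3.2] (`ω(R) ≤ max N` for a numbering
  that separates adjacent vertices), its label form `card_le_card_image_of_isClique`, and the
  complement-dual CLIQUE-COVER BOUND used by MIS solvers: `card_le_card_image_of_cliqueLabel`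
  (an independent set inside `S` has at most `|c '' S|` vertices when the classes of `c` are
  cliques), `indepNum_le_card_image_of_cliqueLabel` (`α(G) ≤ |c '' V|`) and the certificate
  form `indepNum_eq_of_cliqueLabel`;
* `cliqueBlockJoin blk clq R` — the canonical graph with these labels, and
  `isCliqueBlockJoin_cliqueBlockJoin` — it is a clique-block join as soon as (H5) holds, so
  the hypotheses are jointly satisfiable by a real family.

For the one-parameter family benchmarked in [Choi2026GIC, Table 1] (blocks of `4+4k`, `8+4k`,
`3+2k` cliques; `|R| = 10+4k`) the formula reads `α = max (8+4k) (10+4k) = 10+4k`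
(`gic_formula`), attained only by the planted set. Written for the pub-qadeq cell's
instance-level audit of that paper (note DEQ-A38, lemma L5); no statement about the thinned
instances, about the paper's quantum algorithm, or about any complexity class is made here.

Inside `namespace Literature.Combinatorics.SimpleGraph` the Mathlib structure is written
`_root_.SimpleGraph` (the directory name shadows it; CONVENTIONS §2).

## References

* [TomitaSeki2003] E. Tomita, T. Seki, *An efficient branch-and-bound algorithm for finding a
  maximum clique*, DMTCS 2003, LNCS 2731, 278–289, doi:10.1007/3-540-45066-1_22, §3 (the
  approximate-colouring bound).
* [Choi2026GIC] V. Choi, *Exponential Quantum Speedup on Structured Hard Instances of Maximum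
  Independent Set*, arXiv:2601.17686v1 (2026), §2; supplement arXiv:2509.16263.
-/

namespace Literature.Combinatorics.SimpleGraph

open Finset

variable {V β γ : Type*}

section Count

variable [Fintype V] [DecidableEq β] [DecidableEq γ]

/-- `cliqueCount blk clq b`: the number of distinct clique labels carried by the vertices of
block `b` — the number of cliques making up block `b`. [folklore] -/
def cliqueCount (blk : V → β) (clq : V → γ) (b : β) : ℕ :=
  ((univ.filter fun v => blk v = b).image clq).card

/-- Unfolding lemma for `cliqueCount`. [folklore] -/
theorem cliqueCount_def (blk : V → β) (clq : V → γ) (b : β) :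
    cliqueCount blk clq b = ((univ.filter fun v => blk v = b).image clq).card :=
  rfl

/-- A clique label carried by a vertex of block `b` is counted by `cliqueCount … b`. [folklore] -/
theorem clq_mem_image_of_blk_eq (blk : V → β) (clq : V → γ) {b : β} {v : V} (hv : blk v = b) :
    clq v ∈ (univ.filter fun w => blk w = b).image clq :=
  mem_image.2 ⟨v, by simp [hv], rfl⟩

end Count

/-- **Clique-block join** (hypotheses (H1)–(H5) of the module docstring): the pre-thinning
skeleton of the 'GIC' instances of [Choi2026GIC, §2] — blocks `blk`, cliques `clq` inside
blocks, planted set `R`. A `Prop`-valued structure: it asserts a shape of `G`, it does not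
construct anything. [cite: Choi2026GIC, §2 (p. 3)] -/
structure IsCliqueBlockJoin (G : _root_.SimpleGraph V) (blk : V → β) (clq : V → γ)
    (R : Finset V) : Prop where
  /-- (H1) a labelled class inside a block is a clique. -/
  adj_of_clq_eq : ∀ ⦃u v : V⦄, u ≠ v → blk u = blk v → clq u = clq v → G.Adj u v
  /-- (H2) different cliques of the same block are mutually independent. -/
  not_adj_of_clq_ne : ∀ ⦃u v : V⦄, blk u = blk v → clq u ≠ clq v → ¬ G.Adj u v
  /-- (H3) different blocks are completely joined off the planted set. -/
  adj_of_blk_ne : ∀ ⦃u v : V⦄, blk u ≠ blk v → (u ∉ R ∨ v ∉ R) → G.Adj u v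
  /-- (H4) planted vertices of different blocks are non-adjacent. -/
  not_adj_planted : ∀ ⦃u v : V⦄, u ∈ R → v ∈ R → blk u ≠ blk v → ¬ G.Adj u v
  /-- (H5) at most one planted vertex per clique. -/
  clq_ne_of_planted : ∀ ⦃u v : V⦄, u ∈ R → v ∈ R → u ≠ v → blk u = blk v → clq u ≠ clq v

namespace IsCliqueBlockJoin

variable {G : _root_.SimpleGraph V} {blk : V → β} {clq : V → γ} {R : Finset V}

/-- The planted set is independent ((H2), (H4), (H5)). [folklore] -/
theorem isIndepSet_planted (h : IsCliqueBlockJoin G blk clq R) : G.IsIndepSet (R : Set V) := by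
  intro u hu v hv huv
  by_cases hb : blk u = blk v
  · exact h.not_adj_of_clq_ne hb (h.clq_ne_of_planted hu hv huv hb)
  · exact h.not_adj_planted hu hv hb

/-- **Dichotomy**: an independent set of a clique-block join lies inside one block or inside
the planted set — a non-planted member sees every vertex of every other block ((H3)).
[folklore] -/
theorem subset_block_or_subset_planted (h : IsCliqueBlockJoin G blk clq R) {I : Finset V}
    (hI : G.IsIndepSet (I : Set V)) : (∃ b, ∀ v ∈ I, blk v = b) ∨ I ⊆ R := by
  by_cases hIR : I ⊆ R
  · exact Or.inr hIR
  · obtain ⟨w, hwI, hwR⟩ := not_subset.1 hIR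
    refine Or.inl ⟨blk w, fun v hv => ?_⟩
    by_contra hne
    have hvw : v ≠ w := fun e => hne (e ▸ rfl)
    exact hI (mem_coe.2 hv) (mem_coe.2 hwI) hvw (h.adj_of_blk_ne hne (Or.inr hwR))

/-- An independent set inside block `b` has at most one vertex per clique of that block
((H1)), hence at most `cliqueCount blk clq b` vertices. [folklore] -/
theorem card_le_cliqueCount [Fintype V] [DecidableEq β] [DecidableEq γ]
    (h : IsCliqueBlockJoin G blk clq R) {I : Finset V} (hI : G.IsIndepSet (I : Set V)) {b : β}
    (hb : ∀ v ∈ I, blk v = b) : I.card ≤ cliqueCount blk clq b := by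
  have hinj : Set.InjOn clq (I : Set V) := by
    intro u hu v hv huv
    by_contra hne
    exact hI hu hv hne (h.adj_of_clq_eq hne ((hb u hu).trans (hb v hv).symm) huv)
  calc I.card = (I.image clq).card := (card_image_of_injOn hinj).symm
    _ ≤ cliqueCount blk clq b := by
      refine card_le_card fun c hc => ?_
      obtain ⟨v, hv, rfl⟩ := mem_image.1 hc
      exact clq_mem_image_of_blk_eq blk clq (hb v hv)

/-- A transversal of the cliques of block `b` (one vertex per clique) is an independent set of
exactly `cliqueCount blk clq b` vertices ((H2)); so the bound `card_le_cliqueCount` is attained.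
[folklore] -/
theorem exists_transversal [Fintype V] [DecidableEq V] [DecidableEq β] [DecidableEq γ]
    (h : IsCliqueBlockJoin G blk clq R) (b : β) :
    ∃ T : Finset V, G.IsIndepSet (T : Set V) ∧ (∀ v ∈ T, blk v = b) ∧
      T.card = cliqueCount blk clq b := by
  classical
  set S : Finset V := univ.filter fun v => blk v = b with hS
  have hpre : ∀ c ∈ S.image clq, ∃ v ∈ S, clq v = c := fun c hc => mem_image.1 hc
  choose f hfS hfc using hpre
  have hfblk : ∀ c (hc : c ∈ S.image clq), blk (f c hc) = b := fun c hc => by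
    have := hfS c hc
    simpa [hS] using this
  have hfinj : Function.Injective fun c : {c // c ∈ S.image clq} => f c.1 c.2 := by
    intro c c' hcc'
    apply Subtype.ext
    have h1 := hfc c.1 c.2
    have h2 := hfc c'.1 c'.2
    rw [← h1, ← h2]
    exact congrArg clq hcc'
  refine ⟨(S.image clq).attach.image fun c => f c.1 c.2, ?_, ?_, ?_⟩
  · intro u hu v hv huv
    obtain ⟨c, -, rfl⟩ := mem_image.1 (mem_coe.1 hu)
    obtain ⟨c', -, rfl⟩ := mem_image.1 (mem_coe.1 hv)
    have hcc' : c.1 ≠ c'.1 := by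
      intro e
      exact huv (congrArg (fun d : {c // c ∈ S.image clq} => f d.1 d.2) (Subtype.ext e))
    refine h.not_adj_of_clq_ne ((hfblk c.1 c.2).trans (hfblk c'.1 c'.2).symm) ?_
    rwa [hfc c.1 c.2, hfc c'.1 c'.2]
  · intro v hv
    obtain ⟨c, -, rfl⟩ := mem_image.1 hv
    exact hfblk c.1 c.2
  · rw [card_image_of_injective _ hfinj, card_attach, cliqueCount_def]

/-- Every independent set of a clique-block join has at most `max (max_b cliqueCount b) |R|`
vertices. [folklore] -/
theorem card_le_max [Fintype V] [Fintype β] [DecidableEq β] [DecidableEq γ]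
    (h : IsCliqueBlockJoin G blk clq R) {I : Finset V} (hI : G.IsIndepSet (I : Set V)) :
    I.card ≤ max (univ.sup (cliqueCount blk clq)) R.card := by
  rcases h.subset_block_or_subset_planted hI with ⟨b, hb⟩ | hsub
  · exact le_max_of_le_left
      ((h.card_le_cliqueCount hI hb).trans (le_sup (f := cliqueCount blk clq) (mem_univ b)))
  · exact le_max_of_le_right (card_le_card hsub)

/-- **Independence number of a clique-block join**: `α(G) = max (max_b cliqueCount b) |R|` —
the larger of "one vertex per clique of the richest block" and "the planted set"; the
instance family is that of [Choi2026GIC, §2]. [folklore] -/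
theorem indepNum_eq [Fintype V] [Fintype β] [DecidableEq V] [DecidableEq β] [DecidableEq γ]
    (h : IsCliqueBlockJoin G blk clq R) :
    G.indepNum = max (univ.sup (cliqueCount blk clq)) R.card := by
  apply le_antisymm
  · obtain ⟨s, hs⟩ := G.exists_isNIndepSet_indepNum
    rw [← hs.card_eq]
    exact h.card_le_max hs.isIndepSet
  · refine max_le (Finset.sup_le fun b _ => ?_) h.isIndepSet_planted.card_le_indepNum
    obtain ⟨T, hT, -, hcard⟩ := h.exists_transversal b
    rw [← hcard]
    exact hT.card_le_indepNum

/-- When the planted set is at least as large as every block's clique count, `α(G) = |R|`.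
[folklore] -/
theorem indepNum_eq_card_planted [Fintype V] [Fintype β] [DecidableEq V] [DecidableEq β]
    [DecidableEq γ] (h : IsCliqueBlockJoin G blk clq R)
    (hle : univ.sup (cliqueCount blk clq) ≤ R.card) : G.indepNum = R.card := by
  rw [h.indepNum_eq, max_eq_right hle]

/-- **Uniqueness**: when the planted set is STRICTLY larger than every block's clique count,
it is the only independent set of its size. [folklore] -/
theorem eq_planted_of_card_eq [Fintype V] [Fintype β] [DecidableEq β] [DecidableEq γ]
    (h : IsCliqueBlockJoin G blk clq R) (hlt : univ.sup (cliqueCount blk clq) < R.card)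
    {I : Finset V} (hI : G.IsIndepSet (I : Set V)) (hcard : I.card = R.card) : I = R := by
  rcases h.subset_block_or_subset_planted hI with ⟨b, hb⟩ | hsub
  · exfalso
    have h1 := (h.card_le_cliqueCount hI hb).trans (le_sup (f := cliqueCount blk clq) (mem_univ b))
    omega
  · exact eq_of_subset_of_card_le hsub hcard.ge

end IsCliqueBlockJoin

section Canonical

variable (blk : V → β) (clq : V → γ) (R : Finset V)

/-- The **canonical clique-block join** on the labels `blk`, `clq` and the planted set `R`:
`u ~ v` iff `u ≠ v` and either (same block, same clique) or (different blocks, not both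
planted). This is the pre-thinning 'GIC' graph of [Choi2026GIC, §2 (p. 3)] once the labels are
those of its recipe. [cite: Choi2026GIC, §2] -/
def cliqueBlockJoin : _root_.SimpleGraph V where
  Adj u v := u ≠ v ∧ ((blk u = blk v ∧ clq u = clq v) ∨ (blk u ≠ blk v ∧ ¬ (u ∈ R ∧ v ∈ R)))
  symm := ⟨fun _ _ huv =>
    ⟨huv.1.symm, huv.2.imp (fun h' => ⟨h'.1.symm, h'.2.symm⟩)
      (fun h' => ⟨fun e => h'.1 e.symm, fun hh => h'.2 ⟨hh.2, hh.1⟩⟩)⟩⟩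
  loopless := ⟨fun _ hv => hv.1 rfl⟩

/-- Adjacency of the canonical clique-block join, by definition. [folklore] -/
theorem cliqueBlockJoin_adj {u v : V} :
    (cliqueBlockJoin blk clq R).Adj u v ↔
      u ≠ v ∧ ((blk u = blk v ∧ clq u = clq v) ∨ (blk u ≠ blk v ∧ ¬ (u ∈ R ∧ v ∈ R))) :=
  Iff.rfl

/-- Adjacency of the canonical clique-block join is decidable from decidable labels (so small
instances are checkable by `decide`). [folklore] -/
instance [DecidableEq V] [DecidableEq β] [DecidableEq γ] :
    DecidableRel (cliqueBlockJoin blk clq R).Adj := fun u v =>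
  inferInstanceAs (Decidable (u ≠ v ∧
    ((blk u = blk v ∧ clq u = clq v) ∨ (blk u ≠ blk v ∧ ¬ (u ∈ R ∧ v ∈ R)))))

/-- The canonical graph is a clique-block join for its own labels as soon as the planted set
has at most one vertex per clique ((H5)); in particular the hypotheses (H1)–(H5) are jointly
satisfiable. [folklore] -/
theorem isCliqueBlockJoin_cliqueBlockJoin
    (hR : ∀ ⦃u v : V⦄, u ∈ R → v ∈ R → u ≠ v → blk u = blk v → clq u ≠ clq v) :
    IsCliqueBlockJoin (cliqueBlockJoin blk clq R) blk clq R where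
  adj_of_clq_eq u v huv hb hc := ⟨huv, Or.inl ⟨hb, hc⟩⟩
  not_adj_of_clq_ne u v hb hc hadj := by
    rcases hadj.2 with ⟨-, hc'⟩ | ⟨hb', -⟩
    · exact hc hc'
    · exact hb' hb
  adj_of_blk_ne u v hb huv := by
    refine ⟨fun e => hb (e ▸ rfl), Or.inr ⟨hb, fun hh => ?_⟩⟩
    rcases huv with hu | hv
    · exact hu hh.1
    · exact hv hh.2
  not_adj_planted u v hu hv hb hadj := by
    rcases hadj.2 with ⟨hb', -⟩ | ⟨-, hnot⟩
    · exact hb hb'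
    · exact hnot ⟨hu, hv⟩
  clq_ne_of_planted := hR

/-- Hence the independence number of the canonical clique-block join. [folklore] -/
theorem indepNum_cliqueBlockJoin [Fintype V] [Fintype β] [DecidableEq V] [DecidableEq β]
    [DecidableEq γ]
    (hR : ∀ ⦃u v : V⦄, u ∈ R → v ∈ R → u ≠ v → blk u = blk v → clq u ≠ clq v) :
    (cliqueBlockJoin blk clq R).indepNum = max (univ.sup (cliqueCount blk clq)) R.card :=
  (isCliqueBlockJoin_cliqueBlockJoin blk clq R hR).indepNum_eq

end Canonical

section CliqueCover

variable {G : _root_.SimpleGraph V}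

/-- **Approximate-colouring bound of branch-and-bound maximum-clique search**
[cite: TomitaSeki2003, §3.2]: if every vertex `p ∈ R` carries a positive integer `N p` ("Number
or Color") such that adjacent vertices of `R` carry different numbers, then every clique inside
`R` has at most `max {N p | p ∈ R}` vertices — "ω(R) ≤ max{N[p] | p ∈ R}", the pruning rule
`|Q| + max N ≤ |Q_max|` of algorithm MCQ. (Proof as printed: the numbers on a clique are
pairwise distinct and lie in `{1, …, max N}`.) -/
theorem card_le_sup_of_isClique_of_numbering {N : V → ℕ} {R : Finset V}
    (hadj : ∀ ⦃u v : V⦄, u ∈ R → v ∈ R → G.Adj u v → N u ≠ N v) (hpos : ∀ p ∈ R, 1 ≤ N p)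
    {Q : Finset V} (hQ : G.IsClique (Q : Set V)) (hQR : Q ⊆ R) : Q.card ≤ R.sup N := by
  classical
  have hinj : Set.InjOn N (Q : Set V) := by
    intro u hu v hv huv
    by_contra hne
    exact hadj (hQR hu) (hQR hv) (hQ hu hv hne) huv
  calc Q.card = (Q.image N).card := (card_image_of_injOn hinj).symm
    _ ≤ (Icc 1 (R.sup N)).card := by
      refine card_le_card fun n hn => ?_
      obtain ⟨p, hp, rfl⟩ := mem_image.1 hn
      exact mem_Icc.2 ⟨hpos p (hQR hp), le_sup (hQR hp)⟩
    _ = R.sup N := by simp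

/-- The same bound with labels in an arbitrary type: a labelling of `R` that separates adjacent
vertices (a proper colouring of `G[R]`) bounds every clique `Q ⊆ R` by the number of labels used
on `R` [cite: TomitaSeki2003, §3.2 (the "Color" reading of `N`)]. -/
theorem card_le_card_image_of_isClique [DecidableEq γ] {c : V → γ} {R : Finset V}
    (hadj : ∀ ⦃u v : V⦄, u ∈ R → v ∈ R → G.Adj u v → c u ≠ c v)
    {Q : Finset V} (hQ : G.IsClique (Q : Set V)) (hQR : Q ⊆ R) : Q.card ≤ (R.image c).card := by
  have hinj : Set.InjOn c (Q : Set V) := by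
    intro u hu v hv huv
    by_contra hne
    exact hadj (hQR hu) (hQR hv) (hQ hu hv hne) huv
  calc Q.card = (Q.image c).card := (card_image_of_injOn hinj).symm
    _ ≤ (R.image c).card := card_le_card (image_subset_image hQR)

/-- **Clique-cover bound for independent sets** — the complement-dual form in which MIS solvers use
[cite: TomitaSeki2003, §3.2] (maximum independent set of `G` = maximum clique of `Gᶜ`; a colouring
of `Gᶜ[S]` = a partition of `S` into cliques of `G`): if every class of a labelling `c : V → γ` is
a clique of `G` (two distinct vertices with the same label are adjacent), then an independent set
`I ⊆ S` carries pairwise distinct labels, hence `|I| ≤ |c '' S|`. -/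
theorem card_le_card_image_of_cliqueLabel [DecidableEq γ] {c : V → γ}
    (hc : ∀ ⦃u v : V⦄, u ≠ v → c u = c v → G.Adj u v) {I S : Finset V}
    (hI : G.IsIndepSet (I : Set V)) (hIS : I ⊆ S) : I.card ≤ (S.image c).card := by
  have hinj : Set.InjOn c (I : Set V) := by
    intro u hu v hv huv
    by_contra hne
    exact hI hu hv hne (hc hne huv)
  calc I.card = (I.image c).card := (card_image_of_injOn hinj).symm
    _ ≤ (S.image c).card := card_le_card (image_subset_image hIS)

/-- Hence `α(G) ≤ |c '' V|` for every labelling whose classes are cliques: a clique cover with `q`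
parts certifies `α(G) ≤ q` [cite: TomitaSeki2003, §3.2 (dual form)]. -/
theorem indepNum_le_card_image_of_cliqueLabel [Fintype V] [DecidableEq γ] {c : V → γ}
    (hc : ∀ ⦃u v : V⦄, u ≠ v → c u = c v → G.Adj u v) :
    G.indepNum ≤ (univ.image c).card := by
  obtain ⟨s, hs⟩ := G.exists_isNIndepSet_indepNum
  rw [← hs.card_eq]
  exact card_le_card_image_of_cliqueLabel hc hs.isIndepSet (subset_univ s)

/-- Certificate form: an independent set whose size EQUALS the number of parts of some clique
cover is a maximum independent set [cite: TomitaSeki2003, §3.2 (dual form; termination criterion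
of the search)]. -/
theorem indepNum_eq_of_cliqueLabel [Fintype V] [DecidableEq γ] {c : V → γ}
    (hc : ∀ ⦃u v : V⦄, u ≠ v → c u = c v → G.Adj u v) {I : Finset V}
    (hI : G.IsIndepSet (I : Set V)) (hcard : I.card = (univ.image c).card) :
    G.indepNum = I.card :=
  le_antisymm (hcard ▸ indepNum_le_card_image_of_cliqueLabel hc) hI.card_le_indepNum

end CliqueCover

/-- The arithmetic of the benchmarked family of [Choi2026GIC, Table 1]: blocks of `4+4k`,
`8+4k`, `3+2k` cliques and a planted set of `2+6+2 + 4k = 10+4k` representatives give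
`max (max (4+4k) (max (8+4k) (3+2k))) (10+4k) = 10+4k`, and the planted set dominates
strictly (so `eq_planted_of_card_eq` applies). [cite: Choi2026GIC, Table 1] -/
theorem gic_formula (k : ℕ) :
    max (max (4 + 4 * k) (max (8 + 4 * k) (3 + 2 * k))) (10 + 4 * k) = 10 + 4 * k ∧
      max (4 + 4 * k) (max (8 + 4 * k) (3 + 2 * k)) < 10 + 4 * k := by
  constructor <;> omega

end Literature.Combinatorics.SimpleGraph
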